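import Summits.Ventures.CertifiedManyBodySolver.Observables.DWaveOrderParameterCeiling
import Literature.MathematicalPhysics.QuantumLattice.DWaveOrderParameterParticleHole
import HarnessLib

/-!
# OP1-C in IDENTITY FORM, part 8: at `t' = 0` an order-parameter ceiling certified on a chemical-potential bracket holds on the
# MIRROR bracket `[U − μhi, U − μlo]` for free (particle–hole symmetry of `m⋆`)

HONEST FRAMING: soundness / bookkeeping for a CEILING route at positivity scale; a ceiling never speaks to the presence of pairing;
not a superconductivity verdict; nothing in this file is a number. Crew hubbard-obs (D-0042), seat hubbard-obs-p1
(`prover-hubbard-obs-p1-g12-0`), PAIRCORR-SDP §20. Zero compute; no definition; no named fact; no `sorry`.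

`dWaveOrderParameterTT'_zero_particleHole` (Literature, hubbard-obs-p1 g12): `m⋆(0, U; U − μ) = m⋆(0, U; μ)`. Hence the product of a
grand-canonical one-point `μ`-COVER at `t' = 0` (`dWaveOrderParameterTT'_le_of_gcCells`, part 5: `m⋆ ≤ B` on `[μlo, μhi]`) doubles: the same
ceiling holds on `[U − μhi, U − μlo]` — a cover of the hole-doped bracket of density `n` is a cover of the electron-doped bracket of density
`2 − n`, at zero cost (`dWaveOrderParameterTT'_le_of_gcCells_mirror`; pointwise `dWaveOrderParameterTT'_zero_le_of_le_mirror`).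
References: T. Koma, H. Tasaki, J. Stat. Phys. 76 (1994) 745, §1 [KomaTasaki1994]; E. H. Lieb, F. Y. Wu, Physica A 321 (2003) 1, §1 eq. (3)
[LiebWuPhysicaA2003].
-/

noncomputable section

namespace Summit.Ventures.CertifiedManyBodySolver.Observables

open Matrix Complex Finset Literature.MathematicalPhysics.QuantumLattice Literature.Probability.LatticeModels
open Literature.MathematicalPhysics.QuantumLattice.HubbardWave0 ThermodynamicLimit Filter Topology Set
open scoped ComplexOrder ComplexConjugate BigOperators

/-- **Pointwise mirror**: a ceiling `m⋆(0, U; U − μ) ≤ B` is a ceiling `m⋆(0, U; μ) ≤ B`. [cite: KomaTasaki1994, §1] [cite: LiebWuPhysicaA2003, §1 eq. (3)] -/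
theorem dWaveOrderParameterTT'_zero_le_of_le_mirror {U μ B : ℝ} (h : dWaveOrderParameterTT' 0 U (U - μ) ≤ B) :
    dWaveOrderParameterTT' 0 U μ ≤ B := by
  rwa [dWaveOrderParameterTT'_zero_particleHole] at h

/-- **THE MIRROR BRACKET.** Under the hypotheses of `dWaveOrderParameterTT'_le_of_gcCells` at `t' = 0` (grand-canonical one-point cells
covering `[μlo, μhi]`, certified canonical caps pricing the cell caps, cell sentences, `M j ≤ B`): `m⋆(0, U; μ) ≤ B` for EVERY
`μ ∈ [U − μhi, U − μlo]` as well. [cite: KomaTasaki1994, §1] [cite: LiebWuPhysicaA2003, §1 eq. (3)] -/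
theorem dWaveOrderParameterTT'_le_of_gcCells_mirror {U : ℝ} (hU : 0 ≤ U) {μlo μhi : ℝ}
    {J : Type*} (cells : Finset J) (μg Δg ug M n₀ hi : J → ℝ) (hn0 : ∀ j ∈ cells, 0 ≤ n₀ j)
    (hn2 : ∀ j ∈ cells, n₀ j < 2) (hhi : ∀ j ∈ cells, energyDensityTT' 1 0 U (n₀ j) ≤ hi j)
    (hcover : ∀ μ ∈ Set.Icc μlo μhi, ∃ j ∈ cells, |μg j - μ| ≤ Δg j)
    (hug : ∀ j ∈ cells, hi j - μg j * n₀ j + Δg j * max (n₀ j) (2 - n₀ j) ≤ ug j)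
    (hcell : ∀ j ∈ cells, ∀ μc : ℝ, |μg j - μc| ≤ Δg j → ∀ ω : InfVolFermionState 2,
      ω.IsMeanEnergyMinimiser (hubbardTTPrimeSourcedInteraction 1 0 U μc dWaveFormFactor 0) 1 →
      ω.meanEnergy (hubbardTTPrimeSourcedInteraction 1 0 U (μg j) dWaveFormFactor 0) 1 ≤ ug j →
        (ω.expect (pairRegion (insert (0 : Site 2) unitSteps) 0)
          (localPairAt (insert (0 : Site 2) unitSteps) dWaveFormFactor 0)).re ≤ M j)
    {B : ℝ} (hB : ∀ j ∈ cells, M j ≤ B) {μ : ℝ} (hμ : μ ∈ Set.Icc (U - μhi) (U - μlo)) :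
    dWaveOrderParameterTT' 0 U μ ≤ B := by
  refine dWaveOrderParameterTT'_zero_le_of_le_mirror ?_
  exact dWaveOrderParameterTT'_le_of_gcCells hU cells μg Δg ug M n₀ hi hn0 hn2 hhi hcover hug hcell hB
    ⟨by linarith [hμ.2], by linarith [hμ.1]⟩

end Summit.Ventures.CertifiedManyBodySolver.Observables

end
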